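import Mathlib
import Summits.Langlands.Langlands.Theses.PhantomRMYoshida
import Literature.RingTheory.CompleteIntersection.NumericalCriterion
import Literature.NumberTheory.GaloisRepresentations.CompactImageCharpolyIntegral

/-!
# Line `endoscopic-crossing-euler`, Stub 3 (`stub_yoshidaCrossingRT`): the Wiles–Lenstra
# conjuncts are LOGICALLY INERT — kernel-checked (second lead, cycle 1)

`stub_yoshidaCrossingRT` (registered) concludes with an existential package
`∃ S 𝒪 k' jk rbar hb 𝒞 R ρR 𝕋 φ 𝒯 x O' R' T' φ' π' ιR ιT, (C1) ∧ … ∧ (C11)`.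
The standing Disproof (§5 T7) observed that the sorry-free glue DISCARDS (C1)–(C4)
(descent `rbar` of `σ̄ ⊕ σ̄'`, `ρR ∈ 𝒞`, universality of `R`, `𝒯 = tr ρR`).  This file shows that
the remaining conjuncts (C5)–(C11) — surjectivity of `φ : R → 𝕋`, the point `x` with
`x ∘ 𝒯 = tr ρ`, the Criterion-I data `(O', R', T', φ', π')` with `η ≠ 0` and
`length Φ ≤ length Ψ`, the commuting square, the CROSSING `ker ιR ≤ ker x` and DENSITY — are
implied, for ABSTRACT commutative rings `R = 𝕋`, by the bare pro-automorphy statement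

  `ProAut S ρ : ∀ n, ∃ r', (Aut r' ∨ Endo r') ∧ OrdLevel S r' ∧ ∀ g, ‖tr r' g − tr ρ g‖ ≤ p⁻ⁿ`

(= verbatim the hypothesis of Stub 4), via the junk model
`R = 𝕋 = {t : (ℕ → ℚ̄_p) × ℚ̄_p | ‖t₁ n‖, ‖t₂‖ ≤ 1, ‖t₁ n − t₂‖ ≤ p⁻ⁿ}`, `φ = id`, `x = ev_∞`,
`𝒯 g = ((tr r'_n g)ₙ, tr ρ g)`, `y' = ev_n`, and `O' = R' = T' = ℚ̄_p⟦X⟧`, `φ' = π' = id`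
(`η = ⊤`, `Φ = 0`), `ιR = ιT = C ∘ x`.  Conversely the glue gives `(C5)–(C11) ∧ Stub 1 ⇒ ProAut`.
Hence, modulo the TRUE Stub 1 and trace integrality, the numerical-criterion architecture of the
lever constrains its INTENDED PROOF only; the lever's content over `ProAut` is exactly the
deformation-theoretic decoration (C1)–(C4)+(C6) that the composition never uses.  (Same phenomenon as
Disproof T1' for line `yoshida-divisor-selmer-count`.)  No `sorry`; vocabulary copied verbatim from
the stub's `let`s.
-/

noncomputable section

open Literature.NumberTheory.GaloisRepresentations Literature.NumberTheory.Automorphic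
open Literature.RingTheory.CompleteIntersection
open IsDedekindDomain

namespace Summit.Langlands.Langlands.Cruxes.ResiduallyYoshidaLifting.EndoscopicCrossingEuler.Inert

set_option linter.dupNamespace false

variable (p : ℕ) [Fact p.Prime]

/-- The crux's automorphy clause `Aut r` (verbatim the stub's `let Aut`). -/
def Aut (hcpt : isCompact_glFiniteIntegralLevel 4 ℚ) (ι : PadicAlgCl p ≃+* ℂ)
    (r : FramedGaloisRep ℚ (PadicAlgCl p) 4) : Prop :=
  ∃ π : CuspidalAutomorphicRepData 4 ℚ hcpt, π.1.IsLAlgebraic ∧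
    ∀ᶠ v : HeightOneSpectrum (NumberField.RingOfIntegers ℚ) in Filter.cofinite,
      ∃ a : Multiset ℂ, π.1.HasSatakeParamAt v a ∧ r.IsUnramifiedAt v ∧
        r.HasFrobCharpolyAt v (arithFrobPolyOfSatake ι v.residueCard 1 a)

/-- The stub's endoscopic clause `Endo r` (verbatim). -/
def Endo (r : FramedGaloisRep ℚ (PadicAlgCl p) 4) : Prop :=
  ∃ r₁ r₂ : FramedGaloisRep ℚ (PadicAlgCl p) 2, ∀ g, (r g).val.trace = (r₁ g).val.trace + (r₂ g).val.trace

/-- The stub's `OrdLevel S r` (verbatim): Greenberg-ordinary of some regular shape, unramified outside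
`S ∪ {p}`, symplectic for some multiplier. -/
def OrdLevel (S : Finset (HeightOneSpectrum (NumberField.RingOfIntegers ℚ)))
    (r : FramedGaloisRep ℚ (PadicAlgCl p) 4) : Prop :=
  (∃ a : Fin 4 → ℕ, StrictMono a ∧
      ∀ v : HeightOneSpectrum (NumberField.RingOfIntegers ℚ),
        ((p : ℕ) : NumberField.RingOfIntegers ℚ) ∈ v.asIdeal → r.IsGreenbergOrdinaryOfShapeAt v a) ∧
    (∀ v : HeightOneSpectrum (NumberField.RingOfIntegers ℚ),
      ((p : ℕ) : NumberField.RingOfIntegers ℚ) ∉ v.asIdeal → v ∉ S → r.IsUnramifiedAt v) ∧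
    (∃ ν : Field.absoluteGaloisGroup ℚ → PadicAlgCl p, r.IsSymplecticWithMultiplierFun ν)

/-- **`ProAut S ρ`** — ordinary pro-automorphy of tame level `S` (verbatim the hypothesis of Stub 4
`stub_weightTwoClassicality`): `tr ρ` is, for every `n`, uniformly `p⁻ⁿ`-close to the trace of an
automorphic-or-endoscopic `r'` with `OrdLevel S r'`. -/
def ProAut (hcpt : isCompact_glFiniteIntegralLevel 4 ℚ) (ι : PadicAlgCl p ≃+* ℂ)
    (S : Finset (HeightOneSpectrum (NumberField.RingOfIntegers ℚ)))
    (ρ : FramedGaloisRep ℚ (PadicAlgCl p) 4) : Prop :=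
  ∀ n : ℕ, ∃ r' : FramedGaloisRep ℚ (PadicAlgCl p) 4,
    (Aut p hcpt ι r' ∨ Endo p r') ∧ OrdLevel p S r' ∧
      ∀ g, ‖(r' g).val.trace - (ρ g).val.trace‖ ≤ (p : ℝ) ^ (-(n : ℤ))

/-- **Conjuncts (C5)–(C11) of the registered `stub_yoshidaCrossingRT`** (verbatim, in the same binder
order), for ABSTRACT commutative rings `R`, `𝕋` in place of the deformation ring and the Hecke algebra:
`φ : R ↠ 𝕋`, a trace function `𝒯 : Γ_ℚ → R` and a point `x` with `x ∘ 𝒯 = tr ρ`, Criterion-I data over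
a complete DVR `O'` with `η ≠ 0` and `length Φ ≤ length Ψ`, the commuting square `ιT ∘ φ = φ' ∘ ιR`, the
crossing `ker ιR ≤ ker x`, and density of automorphic-or-endoscopic ordinary points at `x`. -/
def Package (hcpt : isCompact_glFiniteIntegralLevel 4 ℚ) (ι : PadicAlgCl p ≃+* ℂ)
    (S : Finset (HeightOneSpectrum (NumberField.RingOfIntegers ℚ)))
    (ρ : FramedGaloisRep ℚ (PadicAlgCl p) 4) : Prop :=
  ∃ (R : Type) (_ : CommRing R) (𝕋 : Type) (_ : CommRing 𝕋)
    (φ : R →+* 𝕋) (𝒯 : Field.absoluteGaloisGroup ℚ → R) (x : R →+* PadicAlgCl p)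
    (O' : Type) (_ : CommRing O') (_ : IsDomain O') (_ : IsDiscreteValuationRing O')
    (_ : IsAdicComplete (IsLocalRing.maximalIdeal O') O')
    (R' : Type) (_ : CommRing R') (_ : IsLocalRing R') (_ : IsNoetherianRing R')
    (_ : IsAdicComplete (IsLocalRing.maximalIdeal R') R') (_ : Algebra O' R')
    (T' : Type) (_ : CommRing T') (_ : IsLocalRing T') (_ : Algebra O' T') (_ : Module.Finite O' T')
    (_ : Module.Free O' T')
    (φ' : R' →ₐ[O'] T') (π' : T' →ₐ[O'] O') (ιR : R →+* R') (ιT : 𝕋 →+* T'),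
    Function.Surjective φ ∧
    (∀ g, x (𝒯 g) = (ρ g).val.trace) ∧
    Function.Surjective φ' ∧ congruenceIdeal π' ≠ ⊥ ∧
    Module.length O' (CotangentModule (π'.comp φ')) ≤ Module.length O' (CongruenceModule π') ∧
    (∀ a, ιT (φ a) = φ' (ιR a)) ∧
    RingHom.ker ιR ≤ RingHom.ker x ∧
    (∀ y : 𝕋 →+* PadicAlgCl p, y.comp φ = x → ∀ n : ℕ,
      ∃ (y' : 𝕋 →+* PadicAlgCl p) (r' : FramedGaloisRep ℚ (PadicAlgCl p) 4),
        (Aut p hcpt ι r' ∨ Endo p r') ∧ OrdLevel p S r' ∧ (∀ g, y' (φ (𝒯 g)) = (r' g).val.trace) ∧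
        ∀ t, ‖y' t - y t‖ ≤ (p : ℝ) ^ (-(n : ℤ)))

variable {p}

/-! ### Trace integrality (compact image) -/

/-- Traces of a continuous `Γ_ℚ`-representation over `ℚ̄_p` have norm `≤ 1` (the characteristic
polynomial is `p`-integral, tree `FramedRep.charpoly_coeff_mem_integer`; `tr = −` its `X³`-coefficient). -/
theorem norm_trace_le_one (r : FramedGaloisRep ℚ (PadicAlgCl p) 4) (g : Field.absoluteGaloisGroup ℚ) :
    ‖(r g).val.trace‖ ≤ 1 := by
  have h := FramedRep.charpoly_coeff_mem_integer r g (Fintype.card (Fin 4) - 1)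
  rw [Matrix.trace_eq_neg_charpoly_coeff, norm_neg]
  have h' : Valued.v (((r g).val.charpoly).coeff (Fintype.card (Fin 4) - 1)) ≤ 1 := h
  rw [PadicAlgCl.valuation_def] at h'
  exact_mod_cast h'

/-! ### The junk model: the congruence ring `𝔠 ⊆ (ℕ → ℚ̄_p) × ℚ̄_p` -/

/-- The congruence subring `𝔠 = {t | ‖t₁ n‖ ≤ 1, ‖t₂‖ ≤ 1, ‖t₁ n − t₂‖ ≤ p⁻ⁿ ∀ n}` of
`(ℕ → ℚ̄_p) × ℚ̄_p` (closed under `+, −, ×, 0, 1` by the ultrametric inequality and integrality). -/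
def congrSubring (p : ℕ) [Fact p.Prime] : Subring ((ℕ → PadicAlgCl p) × PadicAlgCl p) where
  carrier := {t | (∀ n, ‖t.1 n‖ ≤ 1) ∧ ‖t.2‖ ≤ 1 ∧ ∀ n, ‖t.1 n - t.2‖ ≤ (p : ℝ) ^ (-(n : ℤ))}
  mul_mem' := by
    rintro s t ⟨hs1, hs2, hs3⟩ ⟨ht1, ht2, ht3⟩
    refine ⟨fun n => ?_, ?_, fun n => ?_⟩
    · rw [Prod.fst_mul, Pi.mul_apply, norm_mul]
      exact mul_le_one₀ (hs1 n) (norm_nonneg _) (ht1 n)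
    · rw [Prod.snd_mul, norm_mul]
      exact mul_le_one₀ hs2 (norm_nonneg _) ht2
    · rw [Prod.fst_mul, Prod.snd_mul, Pi.mul_apply]
      have hdec : s.1 n * t.1 n - s.2 * t.2 = s.1 n * (t.1 n - t.2) + (s.1 n - s.2) * t.2 := by ring
      rw [hdec]
      refine (IsUltrametricDist.norm_add_le_max _ _).trans (max_le ?_ ?_)
      · rw [norm_mul]
        calc ‖s.1 n‖ * ‖t.1 n - t.2‖ ≤ 1 * (p : ℝ) ^ (-(n : ℤ)) :=
              mul_le_mul (hs1 n) (ht3 n) (norm_nonneg _) zero_le_one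
          _ = (p : ℝ) ^ (-(n : ℤ)) := one_mul _
      · rw [norm_mul]
        calc ‖s.1 n - s.2‖ * ‖t.2‖ ≤ (p : ℝ) ^ (-(n : ℤ)) * 1 :=
              mul_le_mul (hs3 n) ht2 (norm_nonneg _) (by positivity)
          _ = (p : ℝ) ^ (-(n : ℤ)) := mul_one _
  one_mem' := by
    refine ⟨fun n => ?_, ?_, fun n => ?_⟩
    · simp
    · simp
    · simp only [Prod.fst_one, Pi.one_apply, Prod.snd_one, sub_self, norm_zero]
      positivity
  add_mem' := by
    rintro s t ⟨hs1, hs2, hs3⟩ ⟨ht1, ht2, ht3⟩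
    refine ⟨fun n => ?_, ?_, fun n => ?_⟩
    · rw [Prod.fst_add, Pi.add_apply]
      exact (IsUltrametricDist.norm_add_le_max _ _).trans (max_le (hs1 n) (ht1 n))
    · rw [Prod.snd_add]
      exact (IsUltrametricDist.norm_add_le_max _ _).trans (max_le hs2 ht2)
    · rw [Prod.fst_add, Prod.snd_add, Pi.add_apply]
      have hdec : s.1 n + t.1 n - (s.2 + t.2) = (s.1 n - s.2) + (t.1 n - t.2) := by ring
      rw [hdec]
      exact (IsUltrametricDist.norm_add_le_max _ _).trans (max_le (hs3 n) (ht3 n))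
  zero_mem' := by
    refine ⟨fun n => ?_, ?_, fun n => ?_⟩
    · simp
    · simp
    · simp only [Prod.fst_zero, Pi.zero_apply, Prod.snd_zero, sub_self, norm_zero]
      positivity
  neg_mem' := by
    rintro s ⟨hs1, hs2, hs3⟩
    refine ⟨fun n => ?_, ?_, fun n => ?_⟩
    · rw [Prod.fst_neg, Pi.neg_apply, norm_neg]; exact hs1 n
    · rw [Prod.snd_neg, norm_neg]; exact hs2
    · have h : (-s).1 n - (-s).2 = -(s.1 n - s.2) := by
        simp only [Prod.fst_neg, Prod.snd_neg, Pi.neg_apply]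
        ring
      rw [h, norm_neg]
      exact hs3 n

/-- Evaluation at `∞` on `𝔠`: `t ↦ t₂`. -/
def evInfty (p : ℕ) [Fact p.Prime] : congrSubring p →+* PadicAlgCl p :=
  (RingHom.snd (ℕ → PadicAlgCl p) (PadicAlgCl p)).comp (congrSubring p).subtype

/-- Evaluation at `n` on `𝔠`: `t ↦ t₁ n`. -/
def evAt (p : ℕ) [Fact p.Prime] (n : ℕ) : congrSubring p →+* PadicAlgCl p :=
  ((Pi.evalRingHom (fun _ : ℕ => PadicAlgCl p) n).comp
    (RingHom.fst (ℕ → PadicAlgCl p) (PadicAlgCl p))).comp (congrSubring p).subtype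

/-! ### Criterion-I junk data over `ℚ̄_p⟦X⟧` -/

/-- `ℚ̄_p⟦X⟧` is complete for its maximal ideal `(X)`. -/
theorem isAdicComplete_powerSeries :
    IsAdicComplete (IsLocalRing.maximalIdeal (PowerSeries (PadicAlgCl p))) (PowerSeries (PadicAlgCl p)) := by
  rw [PowerSeries.maximalIdeal_eq_span_X]
  infer_instance

/-- For `π' = id : O' → O'` the congruence ideal is `⊤ ≠ ⊥`. -/
theorem congruenceIdeal_id_ne_bot (O' : Type) [CommRing O'] [Nontrivial O'] :
    congruenceIdeal (AlgHom.id O' O') ≠ ⊥ := by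
  intro h
  have h1 : (1 : O') ∈ congruenceIdeal (AlgHom.id O' O') :=
    apply_mem_congruenceIdeal (AlgHom.id O' O') (t := 1) (by
      rw [mem_annihilator_ker_iff]
      intro s hs
      simpa using hs)
  rw [h] at h1
  exact one_ne_zero ((Ideal.mem_bot).mp h1)

/-- For `π' = φ' = id` the cotangent module `ker(id)/ker(id)²` has length `0`. -/
theorem length_cotangent_id (O' : Type) [CommRing O'] :
    Module.length O' (CotangentModule ((AlgHom.id O' O').comp (AlgHom.id O' O'))) = 0 := by
  rw [Module.length_eq_zero_iff]
  refine ⟨fun a b => ?_⟩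
  obtain ⟨a, rfl⟩ := Ideal.toCotangent_surjective _ a
  obtain ⟨b, rfl⟩ := Ideal.toCotangent_surjective _ b
  have ha : a = 0 := Subtype.ext ((RingHom.mem_ker).mp a.2)
  have hb : b = 0 := Subtype.ext ((RingHom.mem_ker).mp b.2)
  rw [ha, hb]

/-! ### The inertness theorem -/

/-- **`ProAut ⇒ Package`**: the conjuncts (C5)–(C11) of the registered lever are satisfied by the
junk model of the module docstring as soon as `tr ρ` is a `p`-adic limit of automorphic-or-endoscopic
ordinary traces of level `S`.  So, for abstract `R, 𝕋`, the Wiles–Lenstra data, the crossing and the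
density clause carry no content beyond `ProAut S ρ` (= the hypothesis of Stub 4). -/
theorem package_of_proAut (hcpt : isCompact_glFiniteIntegralLevel 4 ℚ) (ι : PadicAlgCl p ≃+* ℂ)
    (S : Finset (HeightOneSpectrum (NumberField.RingOfIntegers ℚ)))
    (ρ : FramedGaloisRep ℚ (PadicAlgCl p) 4) (h : ProAut p hcpt ι S ρ) :
    Package p hcpt ι S ρ := by
  classical
  choose r' hr' using h
  -- the trace function `𝒯 g = ((tr r'_n g)_n, tr ρ g) ∈ 𝔠`
  have hmem : ∀ g, ((fun n => (r' n g).val.trace), (ρ g).val.trace) ∈ congrSubring p := fun g =>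
    ⟨fun n => norm_trace_le_one (r' n) g, norm_trace_le_one ρ g, fun n => (hr' n).2.2 g⟩
  let 𝒯 : Field.absoluteGaloisGroup ℚ → congrSubring p := fun g => ⟨_, hmem g⟩
  haveI : IsAdicComplete (IsLocalRing.maximalIdeal (PowerSeries (PadicAlgCl p)))
      (PowerSeries (PadicAlgCl p)) := isAdicComplete_powerSeries
  let ιR : congrSubring p →+* PowerSeries (PadicAlgCl p) :=
    (PowerSeries.C : PadicAlgCl p →+* PowerSeries (PadicAlgCl p)).comp (evInfty p)
  refine ⟨↥(congrSubring p), inferInstance, ↥(congrSubring p), inferInstance, RingHom.id _, 𝒯, evInfty p,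
    PowerSeries (PadicAlgCl p), inferInstance, inferInstance, inferInstance, inferInstance,
    PowerSeries (PadicAlgCl p), inferInstance, inferInstance, inferInstance, inferInstance,
    inferInstance,
    PowerSeries (PadicAlgCl p), inferInstance, inferInstance, inferInstance, inferInstance,
    inferInstance,
    AlgHom.id _ _, AlgHom.id _ _, ιR, ιR, Function.surjective_id, fun g => rfl,
    Function.surjective_id, congruenceIdeal_id_ne_bot _, ?_, fun a => rfl, ?_, ?_⟩
  · rw [length_cotangent_id]
    exact bot_le
  · -- crossing: `ker (C ∘ ev_∞) = ker ev_∞`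
    intro a ha
    rw [RingHom.mem_ker] at ha ⊢
    have : (PowerSeries.C : PadicAlgCl p →+* PowerSeries (PadicAlgCl p)) (evInfty p a) = 0 := ha
    rwa [map_eq_zero_iff _ (PowerSeries.C_injective)] at this
  · -- density: `y = ev_∞`, `y' = ev_n`, `r' = r'_n`
    intro y hy n
    have hy' : y = evInfty p := by rw [← hy]; rfl
    subst hy'
    refine ⟨evAt p n, r' n, (hr' n).1, (hr' n).2.1, fun g => rfl, fun t => ?_⟩
    exact t.2.2.2 n

/-- **Conversely (the glue, verbatim): `Package ∧ (numerical criterion) ⇒ ProAut`.**  With Stub 1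
(`stub_numericalCriterion`, true: dSRS Criterion I) the registered lever's conjuncts (C5)–(C11) give back
exactly `ProAut S ρ`.  Together with `package_of_proAut`: (C5)–(C11) ⟺ ProAut modulo Stub 1. -/
theorem proAut_of_package
    (h1 : ∀ (O : Type) [CommRing O] [IsDomain O] [IsDiscreteValuationRing O]
      [IsAdicComplete (IsLocalRing.maximalIdeal O) O]
      (R : Type) [CommRing R] [IsLocalRing R] [IsNoetherianRing R]
      [IsAdicComplete (IsLocalRing.maximalIdeal R) R] [Algebra O R]
      (T : Type) [CommRing T] [IsLocalRing T] [Algebra O T] [Module.Finite O T] [Module.Free O T]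
      (φ : R →ₐ[O] T) (π : T →ₐ[O] O),
      Function.Surjective φ → congruenceIdeal π ≠ ⊥ →
        Module.length O (CotangentModule (π.comp φ)) ≤ Module.length O (CongruenceModule π) →
          Function.Bijective φ)
    (hcpt : isCompact_glFiniteIntegralLevel 4 ℚ) (ι : PadicAlgCl p ≃+* ℂ)
    (S : Finset (HeightOneSpectrum (NumberField.RingOfIntegers ℚ)))
    (ρ : FramedGaloisRep ℚ (PadicAlgCl p) 4) (h : Package p hcpt ι S ρ) :
    ProAut p hcpt ι S ρ := by
  obtain ⟨R, _, 𝕋, _, φ, 𝒯, x, O', _, _, _, _, R', _, _, _, _, _, T', _, _, _, _, _, φ', π', ιR, ιT,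
    hφ, hx, hφ', hη, hle, hcomm, hcross, hdens⟩ := h
  have hbij : Function.Bijective φ' := h1 O' R' T' φ' π' hφ' hη hle
  have hker : RingHom.ker φ ≤ RingHom.ker x := by
    intro a ha
    apply hcross
    rw [RingHom.mem_ker] at ha ⊢
    apply hbij.1
    rw [← hcomm, ha, map_zero, map_zero]
  obtain ⟨y, hy⟩ : ∃ y : 𝕋 →+* PadicAlgCl p, y.comp φ = x :=
    ⟨RingHom.liftOfSurjective φ hφ ⟨x, hker⟩, RingHom.liftOfSurjective_comp φ hφ ⟨x, hker⟩⟩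
  intro n
  obtain ⟨y', r', hcls, hlev, htr, hclose⟩ := hdens y hy n
  refine ⟨r', hcls, hlev, fun g => ?_⟩
  have h1 : (ρ g).val.trace = y (φ (𝒯 g)) := by
    rw [← hx g, ← hy]
    rfl
  rw [h1, ← htr g]
  exact hclose _

end Summit.Langlands.Langlands.Cruxes.ResiduallyYoshidaLifting.EndoscopicCrossingEuler.Inert
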